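import Summits.RiemannHypothesis.RiemannHypothesis.Theorems.SuzukiPhiFredholm
import Summits.RiemannHypothesis.RiemannHypothesis.Theorems.SuzukiWindowsDoorExplicitWindowPolarUniversal
import Summits.RiemannHypothesis.RiemannHypothesis.Theorems.SuzukiCleanRadiusDefs

/-!
# SuzukiPhiFredholmWindows — Suzuki's `φ^±` on the cell's CLEAN windows for `K_θ`, and continuity of `φ^ε(t,·)`
# (column DBR; RH-FREE, ζ-free operator theory)

LINE 1 — LABEL: RH-FREE; bears_on LADDER-RH B-P(P2)/(P3) (dictionary «clean window ⇒ canonical-system data exist»).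
WHAT THIS IS NOT: no new clean window, no positivity, nothing about zeros of `ζ`; nothing here bears on the truth of RH.

Companion of `Theorems/SuzukiPhiFredholm` ([rh-dbr-eng] g7: Suzuki JFA 281 (2021) 109116 Lemma 3.3 on every clean window
`NoUnitEigenvalue K t` by the Fredholm alternative):
* `continuous_winPotential`, `continuous_suzukiPhiExt` — `φ^ε(t,·) = suzukiPhiExt K ε t` is CONTINUOUS on `ℝ` for every
  continuous kernel vanishing on `(−∞,0)` (Lemma 3.3/3.4 continuity clause; dominated convergence on the window), and the
  package `suzukiPhiExt_spec_of_noUnitEigenvalue` (solution ∧ continuous ∧ vanishing on `(−∞,−t)` ∧ pointwise-unique);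
* INSTANCES for `K_θ = limKernel θ` ([Su20] (1.4)): `exists_isSuzukiPhiSolution_limKernel_of_cleanUpTo` (every
  `CleanUpTo θ T` family) and the cell's UNIVERSAL POLAR LAW (rh-dbr-eng-3, `noUnitEigenvalue_limKernel_of_le_polar`):
  for every real `θ ≥ 4` and every `t ≤ (θ−1)/28`, Suzuki's `φ^±_t` exist, are a.e. unique, and equal
  `suzukiPhiExt (limKernel θ) (±1) t` pointwise on `(−∞,t]`;
* (RH-IMPLIED remark, not imported here to keep this module outside the route cone: under `RiemannHypothesis`, for
  `θ > 10` EVERY window is clean — `SuzukiWindowsDoorConverse.noUnitEigenvalue_limKernel_of_riemannHypothesis`, with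
  `SuzukiDoor.limKernel = limKernel` by `rfl` — so `exists_isSuzukiPhiSolution_of_noUnitEigenvalue` gives Suzuki's
  canonical-system data for `K_θ` at every `t ≥ 0`.)

References: [Su21] M. Suzuki, J. Funct. Anal. 281 (2021) 109116, §3.3 Lemma 3.3, Lemma 3.4, (3.4)–(3.8); [Su20] M. Suzuki,
ASPM 84 (2020) (1.4).
-/

noncomputable section

-- D-0017: `Summit.<S>.<S>.…` is the designed namespace of a single-problem summit.
set_option linter.dupNamespace false

open MeasureTheory Set Filter Topology

namespace Summit.RiemannHypothesis.RiemannHypothesis.Theorems.SuzukiPhiExistence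

open Literature.NumberTheory.LFunctions Literature.Analysis.OperatorTheory
open Summit.RiemannHypothesis.RiemannHypothesis.Theorems.SuzukiKernelSemigroup (limKernel_eq_zero_of_nonpos)
open Summit.RiemannHypothesis.RiemannHypothesis.Theorems.SuzukiWindowsDoorExplicitWindowPolarUniversal
  (noUnitEigenvalue_limKernel_of_le_polar)
open Summit.RiemannHypothesis.RiemannHypothesis.Theorems.SuzukiCleanRadius (CleanUpTo)

variable {K : ℝ → ℝ} {t ε : ℝ}

/-! ## §4 Instances: Suzuki's single-operator kernels `K_θ` on the cell's kernel CLEAN windows -/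

/-- RH-FREE.  **On every clean-window family `CleanUpTo θ T`** (`∀ 0 ≤ t ≤ T`, `±1 ∉ spec 𝖪_θ[t]`), Suzuki's `φ^±_t`
for `K_θ` exist at every `0 ≤ t ≤ T`. -/
theorem exists_isSuzukiPhiSolution_limKernel_of_cleanUpTo {θ T : ℝ} (hθ : 1 < θ) (hC : CleanUpTo θ T)
    (ht0 : 0 ≤ t) (htT : t ≤ T) (hε : ε = 1 ∨ ε = -1) : ∃ X : ℝ → ℝ, IsSuzukiPhiSolution (limKernel θ) ε t X :=
  exists_isSuzukiPhiSolution_of_noUnitEigenvalue (Suzuki2020_thm12_continuous hθ)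
    (fun _ hu ↦ limKernel_eq_zero_of_nonpos hθ hu) hε (hC t ht0 htT)

/-- RH-FREE.  … with a.e. uniqueness. -/
theorem isSuzukiPhiSolution_limKernel_ae_unique_of_cleanUpTo {θ T : ℝ} (hθ : 1 < θ) (hC : CleanUpTo θ T)
    (ht0 : 0 ≤ t) (htT : t ≤ T) (hε : ε = 1 ∨ ε = -1) {X Y : ℝ → ℝ}
    (hX : IsSuzukiPhiSolution (limKernel θ) ε t X) (hY : IsSuzukiPhiSolution (limKernel θ) ε t Y) :
    X =ᵐ[volume.restrict (Iic t)] Y :=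
  isSuzukiPhiSolution_ae_unique_of_noUnitEigenvalue (Suzuki2020_thm12_continuous hθ)
    (fun _ hu ↦ limKernel_eq_zero_of_nonpos hθ hu) ht0 hε (hC t ht0 htT) hX hY

/-- **RH-FREE · THE UNIVERSAL POLAR LAW CARRIES CANONICAL-SYSTEM DATA**: for every real `θ ≥ 4` and every window
`t ≤ (θ−1)/28`, Suzuki's `φ^±_t` for `K_θ` exist (rh-dbr-eng-3's `noUnitEigenvalue_limKernel_of_le_polar` + Lemma 3.3). -/
theorem exists_isSuzukiPhiSolution_limKernel_polar {θ : ℝ} (hθ : 4 ≤ θ) (ht : t ≤ (θ - 1) / 28)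
    (hε : ε = 1 ∨ ε = -1) : ∃ X : ℝ → ℝ, IsSuzukiPhiSolution (limKernel θ) ε t X :=
  exists_isSuzukiPhiSolution_of_noUnitEigenvalue (Suzuki2020_thm12_continuous (by linarith))
    (fun _ hu ↦ limKernel_eq_zero_of_nonpos (by linarith) hu) hε (noUnitEigenvalue_limKernel_of_le_polar hθ ht)

/-- RH-FREE.  … with a.e. uniqueness (`0 ≤ t ≤ (θ−1)/28`). -/
theorem isSuzukiPhiSolution_limKernel_polar_ae_unique {θ : ℝ} (hθ : 4 ≤ θ) (ht0 : 0 ≤ t) (ht : t ≤ (θ - 1) / 28)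
    (hε : ε = 1 ∨ ε = -1) {X Y : ℝ → ℝ}
    (hX : IsSuzukiPhiSolution (limKernel θ) ε t X) (hY : IsSuzukiPhiSolution (limKernel θ) ε t Y) :
    X =ᵐ[volume.restrict (Iic t)] Y :=
  isSuzukiPhiSolution_ae_unique_of_noUnitEigenvalue (Suzuki2020_thm12_continuous (by linarith))
    (fun _ hu ↦ limKernel_eq_zero_of_nonpos (by linarith) hu) ht0 hε (noUnitEigenvalue_limKernel_of_le_polar hθ ht)
    hX hY

/-- RH-FREE.  On the polar windows the tree's `suzukiPhiExt (limKernel θ) (±1) t` is THE solution (choice-free):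
every solution agrees with it pointwise on `(−∞,t]`. -/
theorem eq_suzukiPhiExt_limKernel_polar {θ : ℝ} (hθ : 4 ≤ θ) (ht0 : 0 ≤ t) (ht : t ≤ (θ - 1) / 28)
    (hε : ε = 1 ∨ ε = -1) {X : ℝ → ℝ} (hX : IsSuzukiPhiSolution (limKernel θ) ε t X) {x : ℝ} (hx : x ≤ t) :
    X x = suzukiPhiExt (limKernel θ) ε t x :=
  eq_suzukiPhiExt_of_noUnitEigenvalue (Suzuki2020_thm12_continuous (by linarith))
    (fun _ hu ↦ limKernel_eq_zero_of_nonpos (by linarith) hu) ht0 hε (noUnitEigenvalue_limKernel_of_le_polar hθ ht)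
    hX hx

/-! ## §5 Continuity of Suzuki's extended solution `φ^ε(t,·)` (Lemma 3.3/3.4) -/

/-- RH-FREE.  **Continuity of a window potential**: for continuous `K` and `X ∈ L²(−t,t)`, the function
`x ↦ ∫_{(−t,t)} K(x+y) X(y) dy` is continuous on `ℝ` (dominated convergence on compact `x`-ranges). -/
theorem continuous_winPotential (hK : Continuous K) {X : ℝ → ℝ} (hX : MemLp X 2 (volume.restrict (Ioo (-t) t))) :
    Continuous fun x : ℝ ↦ ∫ y in Ioo (-t) t, K (x + y) * X y := by
  haveI : IsFiniteMeasure (volume.restrict (Ioo (-t) t)) := by infer_instance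
  have hXi : Integrable X (volume.restrict (Ioo (-t) t)) := hX.integrable one_le_two
  refine continuous_iff_continuousAt.2 fun x₀ ↦ ?_
  obtain ⟨C, hC⟩ := (isCompact_Icc (a := x₀ - 1 - |t|) (b := x₀ + 1 + |t|)).exists_bound_of_continuousOn
    hK.continuousOn
  have hball : ∀ᶠ x in 𝓝 x₀, |x - x₀| < 1 := by
    have : Ioo (x₀ - 1) (x₀ + 1) ∈ 𝓝 x₀ := Ioo_mem_nhds (by linarith) (by linarith)
    filter_upwards [this] with x hx
    exact abs_lt.2 ⟨by linarith [hx.1], by linarith [hx.2]⟩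
  refine continuousAt_of_dominated (bound := fun y ↦ C * ‖X y‖) ?_ ?_ (hXi.norm.const_mul C) ?_
  · exact Eventually.of_forall fun x ↦
      ((hK.comp (continuous_const.add continuous_id)).aestronglyMeasurable).mul hXi.aestronglyMeasurable
  · filter_upwards [hball] with x hx
    refine (ae_restrict_iff' measurableSet_Ioo).2 (Eventually.of_forall fun y hy ↦ ?_)
    rw [norm_mul]
    refine mul_le_mul_of_nonneg_right (hC (x + y) ⟨?_, ?_⟩) (norm_nonneg _)
    · have := (abs_lt.1 hx).1; linarith [hy.1, le_abs_self t, neg_abs_le t]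
    · have := (abs_lt.1 hx).2; linarith [hy.2, le_abs_self t]
  · exact Eventually.of_forall fun y ↦
      ((hK.comp (continuous_id.add continuous_const)).mul continuous_const).continuousAt

/-- RH-FREE.  For a kernel vanishing on `(−∞,0)`, the `(−∞,t]`-integral defining `suzukiPhiExt` lives on the window at
EVERY real `x`: `∫_{(−∞,t]} K(x+y) φ^ε(t,y) dy = ∫_{(−t,t)} K(x+y) φ^ε(t,y) dy` (`φ^ε(t,·) = 0` on `(−∞,−t)`). -/
theorem setIntegral_Iic_kernel_mul_suzukiPhiExt_eq (hK3 : ∀ u : ℝ, u < 0 → K u = 0) (ε t x : ℝ) :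
    ∫ y in Iic t, K (x + y) * suzukiPhiExt K ε t y = ∫ y in Ioo (-t) t, K (x + y) * suzukiPhiExt K ε t y := by
  have h1 : ∫ y in Iic t, K (x + y) * suzukiPhiExt K ε t y = ∫ y in Icc (-t) t, K (x + y) * suzukiPhiExt K ε t y := by
    refine setIntegral_eq_of_subset_of_forall_sdiff_eq_zero measurableSet_Iic Icc_subset_Iic_self ?_
    intro y hy
    have hy' : y < -t := by
      rcases hy with ⟨hy1, hy2⟩
      by_contra h
      exact hy2 ⟨le_of_not_gt h, hy1⟩
    rw [suzukiPhiExt_eq_zero_of_lt_neg hK3 hy', mul_zero]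
  rw [h1]
  exact (setIntegral_congr_set (Ioo_ae_eq_Icc (μ := (volume : Measure ℝ)))).symm

/-- **RH-FREE · `φ^ε(t,·)` IS CONTINUOUS ON `ℝ`** (Suzuki JFA21 Lemma 3.3: «a real-valued continuous function on
`(−∞,t]`»; (3.7)/(3.8): the extension to `ℝ` is continuous as well) — for EVERY continuous kernel vanishing on `(−∞,0)`
and every `ε`, `t` (when (3.4) has no solution, `suzukiPhiExt = 0`). -/
theorem continuous_suzukiPhiExt (hK : Continuous K) (hK3 : ∀ u : ℝ, u < 0 → K u = 0) (ε t : ℝ) :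
    Continuous (suzukiPhiExt K ε t) := by
  by_cases h : ∃ X, IsSuzukiPhiSolution K ε t X
  · have hsol := isSuzukiPhiSolution_suzukiPhiExt h
    have hmem : MemLp (suzukiPhiExt K ε t) 2 (volume.restrict (Ioo (-t) t)) :=
      hsol.1.mono_measure (Measure.restrict_mono (fun y hy ↦ (hy.2.le : y ≤ t)) le_rfl)
    have e : suzukiPhiExt K ε t =
        fun x ↦ K (x + t) - ε * ∫ y in Ioo (-t) t, K (x + y) * suzukiPhiExt K ε t y := by
      funext x
      rw [← setIntegral_Iic_kernel_mul_suzukiPhiExt_eq hK3 ε t x]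
      exact suzukiPhiExt_eq h x
    rw [e]
    exact (hK.comp (continuous_id.add continuous_const)).sub
      (continuous_const.mul (continuous_winPotential hK hmem))
  · rw [suzukiPhiExt_of_not_exists h]
    exact continuous_zero

/-- **RH-FREE · LEMMA 3.3 ON A CLEAN WINDOW, PACKAGED**: for `K` continuous vanishing on `(−∞,0]`, `ε = ±1`, `t ≥ 0` with
`NoUnitEigenvalue K t`, the tree's `φ^ε(t,·) = suzukiPhiExt K ε t` is a CONTINUOUS solution of (3.4) vanishing on
`(−∞,−t)`, and every `L²(−∞,t)` solution coincides with it pointwise on `(−∞,t]`. -/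
theorem suzukiPhiExt_spec_of_noUnitEigenvalue (hK : Continuous K) (hK0 : ∀ u : ℝ, u ≤ 0 → K u = 0) (ht : 0 ≤ t)
    (hε : ε = 1 ∨ ε = -1) (hN : NoUnitEigenvalue K t) :
    IsSuzukiPhiSolution K ε t (suzukiPhiExt K ε t) ∧ Continuous (suzukiPhiExt K ε t) ∧
      (∀ x : ℝ, x < -t → suzukiPhiExt K ε t x = 0) ∧
      ∀ X : ℝ → ℝ, IsSuzukiPhiSolution K ε t X → ∀ x : ℝ, x ≤ t → X x = suzukiPhiExt K ε t x :=
  ⟨isSuzukiPhiSolution_suzukiPhiExt_of_noUnitEigenvalue hK hK0 hε hN,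
    continuous_suzukiPhiExt hK (fun u hu ↦ hK0 u hu.le) ε t,
    fun _ hx ↦ suzukiPhiExt_eq_zero_of_lt_neg (fun u hu ↦ hK0 u hu.le) hx,
    fun _ hX _ hx ↦ eq_suzukiPhiExt_of_noUnitEigenvalue hK hK0 ht hε hN hX hx⟩

end Summit.RiemannHypothesis.RiemannHypothesis.Theorems.SuzukiPhiExistence

end
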